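import Literature.Probability.Percolation.SlabCircuitGlueSurgery
import Literature.Probability.Percolation.SlabRSWGluingBound
import HarnessLib

/-!
# Newman–Tassion–Wu 2017, Theorem 3.8 / CPAM Theorem 3.10 — the circuit gluing lemma, LINEAR regime:
# `P[C̄ ⟷ Γ̄-columns] ≤ (1 + λ^{5k+4}) · P[C̄ ⟷ Γ]`

Topic: `Literature/Probability/Percolation`.  Fourth file of the circuit gluing layer.  NTW's Lemma 3.5
(the tree's `lemma7_bond`) applied to the one-column vertical surgery `exists_vGadget`
(`SlabCircuitGlueSurgery.lean`): every lattice configuration of `𝒳 = {C̄ ⟷^{W̄} col(Γ)} ∖ {C̄ ⟷^{W̄} Γ}`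
has an image in `{C̄ ⟷^{W̄} Γ}` differing from it on the pairs of ONE column, which is read off the
image (the column of the recovery statistic `att`).  Hence, for every `CircGlue` datum (any finite world,
any source off the box of the annulus) and `0 < p < 1`,
`P_p[𝒳] ≤ λ^{5k+4} P_p[C̄ ⟷ Γ]` and `P_p[C̄ ⟷ col(Γ)] ≤ (1 + λ^{5k+4}) P_p[C̄ ⟷ Γ]`, `λ = 2/min{p,1-p}` —
NTW's Remark 3 ("`h₀(x) ≥ c₀ x`") for the circuit gluing lemma.

* `real_le_of_statMods` — Lemma 3.5 for modifications read off ONE recovery statistic (abstract: any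
  finite window, any source/target events determined by it).
* `CircGlue.Γ_congr_annulus`, `.mem_evCol_congr`, `.mem_evGlued_congr` — locality in the world.
* `CircGlue.exists_mem_Uent_of_evX` — on `𝒳` (lattice configurations) entry cells exist.
* `CircGlue.real_evX_le`, **`CircGlue.circuitGlue_linear`**.

## Sources

* C. M. Newman, V. Tassion, W. Wu, *Critical percolation and the minimal spanning tree in slabs*,
  Comm. Pure Appl. Math. 70 (2017) = arXiv:1512.09107: §3.2, Lemma 3.5; Theorem 3.8 (arXiv) = Theorem
  3.10 (CPAM), (3.5)–(3.8) with Remark 3 after Theorem 3.7/3.9 [NewmanTassionWu2017].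
-/

noncomputable section

namespace Literature.Probability.Percolation

open MeasureTheory LatticeModels SimpleGraph Finset

namespace NTW17

variable {k : ℕ}

/-! ## Lemma 3.5 for modifications read off one statistic -/

/-- **NTW's Lemma 3.5, one recovery statistic.**  Let `K'` be a finite window of pairs containing the
pairs of the finite vertex set `Rw`, `E`, `F` events determined by `K'`, `stat` any set-valued statistic.
If every lattice `ω ∈ E` has `ω' ∈ F` with `ω' ⊆ ω ∪ {lattice pairs of Rw}` agreeing with `ω` off the pairs
touching the columns over a set `D` contained in a box of radius `r` over which the non-empty statistic
`stat ω'` lies, then `P_p[E] ≤ λ^{(5k+4)(4r+1)²} P_p[F]`, `λ = 2/min{p,1-p}`.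
[cite: NewmanTassionWu2017, §3.2 (Lemma 3.5; proof of Theorem 3.7, second part)] -/
theorem real_le_of_statMods (Rw : Set (slab 3 k)) (K' : Finset (Sym2 (slab 3 k))) (hK'R : Rw.sym2 ⊆ ↑K')
    {E F : Set (BondConfig (slab 3 k))} (hE : DeterminedBy E ↑K') (hF : DeterminedBy F ↑K')
    (stat : BondConfig (slab 3 k) → Set (slab 3 k)) (r : ℕ) (p : unitInterval) (hp0 : 0 < (p : ℝ))
    (hp1 : (p : ℝ) < 1)
    (hmod : ∀ ω : BondConfig (slab 3 k), ω ⊆ (slabGraph 3 k).edgeSet → ω ∈ E → ∃ ω', ω' ∈ F ∧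
      (∀ e ∈ ω', e ∈ ω ∨ (e ∈ (slabGraph 3 k).edgeSet ∧ e ∈ Rw.sym2)) ∧
      ∃ D : Set (ℤ × ℤ), (∀ e, e ∉ touch k D → (e ∈ ω ↔ e ∈ ω')) ∧ (∃ z : ℤ × ℤ, D ⊆ sqBox z r) ∧
        (stat ω').Nonempty ∧ stat ω' ⊆ slabLift k D) :
    (bondPercolation (slabGraph 3 k) p).real E ≤
      (2 / min (p : ℝ) (1 - p)) ^ ((5 * k + 4) * (2 * (2 * r) + 1) ^ 2) *
        (bondPercolation (slabGraph 3 k) p).real F := by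
  classical
  set P := bondPercolation (slabGraph 3 k) p with hP
  let gad : ∀ ω : BondConfig (slab 3 k), ω ⊆ (slabGraph 3 k).edgeSet ∧ ω ∈ E → BondConfig (slab 3 k) :=
    fun ω h => Classical.choose (hmod ω h.1 h.2)
  have hgad' : ∀ ω (h : ω ⊆ (slabGraph 3 k).edgeSet ∧ ω ∈ E), gad ω h ∈ F ∧
      (∀ e ∈ gad ω h, e ∈ ω ∨ (e ∈ (slabGraph 3 k).edgeSet ∧ e ∈ Rw.sym2)) ∧
      ∃ D : Set (ℤ × ℤ), (∀ e, e ∉ touch k D → (e ∈ ω ↔ e ∈ gad ω h)) ∧ (∃ z : ℤ × ℤ, D ⊆ sqBox z r) ∧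
        (stat (gad ω h)).Nonempty ∧ stat (gad ω h) ⊆ slabLift k D :=
    fun ω h => Classical.choose_spec (hmod ω h.1 h.2)
  set Kfin : Finset (Sym2 (slab 3 k)) := K'.filter (· ∈ (slabGraph 3 k).edgeSet) with hKfin
  have hK : ∀ e, e ∈ Kfin ↔ e ∈ K' ∧ e ∈ (slabGraph 3 k).edgeSet := fun e => Finset.mem_filter
  have hKE : ∀ e ∈ Kfin, e ∈ (slabGraph 3 k).edgeSet := fun e he => ((hK e).1 he).2
  have hlat : ∀ S : Finset (Sym2 (slab 3 k)), S ⊆ Kfin →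
      (↑S : Set (Sym2 (slab 3 k))) ⊆ (slabGraph 3 k).edgeSet := fun S hS e he => hKE e (hS he)
  have hnewK : ∀ (S : Finset (Sym2 (slab 3 k))) (hS : S ⊆ Kfin) (hSX : (↑S : BondConfig (slab 3 k)) ∈ E),
      gad ↑S ⟨hlat S hS, hSX⟩ ⊆ ↑Kfin := by
    intro S hS hSX e he
    rcases (hgad' (↑S) ⟨hlat S hS, hSX⟩).2.1 e he with h | ⟨h1, h2⟩
    · exact hS h
    · rw [Finset.mem_coe, hK]
      exact ⟨hK'R h2, h1⟩
  have hcoe : ∀ (S : Finset (Sym2 (slab 3 k))) (hS : S ⊆ Kfin) (hSX : (↑S : BondConfig (slab 3 k)) ∈ E),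
      (↑(Kfin.filter (· ∈ gad ↑S ⟨hlat S hS, hSX⟩)) : Set (Sym2 (slab 3 k))) = gad ↑S ⟨hlat S hS, hSX⟩ := by
    intro S hS hSX
    ext e
    simp only [Finset.coe_filter, Set.mem_setOf_eq, and_iff_right_iff_imp]
    exact fun he => hnewK S hS hSX he
  set Φ : Finset (Sym2 (slab 3 k)) → Finset (Finset (Sym2 (slab 3 k))) := fun S =>
    if h : (↑S : Set (Sym2 (slab 3 k))) ⊆ (slabGraph 3 k).edgeSet ∧ (↑S : BondConfig (slab 3 k)) ∈ E
    then {Kfin.filter (· ∈ gad ↑S h)} else ∅ with hΦ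
  have hΦ_of : ∀ (S : Finset (Sym2 (slab 3 k)))
      (h : (↑S : Set (Sym2 (slab 3 k))) ⊆ (slabGraph 3 k).edgeSet ∧ (↑S : BondConfig (slab 3 k)) ∈ E),
      Φ S = {Kfin.filter (· ∈ gad ↑S h)} := fun S h => dif_pos h
  set lam : ℝ := 2 / min (p : ℝ) (1 - p) with hlam
  set s : ℕ := (5 * k + 4) * (2 * (2 * r) + 1) ^ 2 with hs
  let box : slab 3 k → Finset (Sym2 (slab 3 k)) := fun q₀ =>
    Kfin.filter fun e => ∃ u ∈ e, planar k u ∈ (sqBox_finite (planar k q₀) (2 * r)).toFinset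
  have hbox_card : ∀ q₀, (box q₀).card ≤ s := by
    intro q₀
    refine (card_filter_colEdges_le k Kfin hKE _).trans ?_
    have := card_toFinset_sqBox_le (planar k q₀) (2 * r)
    rw [hs]; exact Nat.mul_le_mul_left _ this
  have hbox_agree : ∀ (S S' : Finset (Sym2 (slab 3 k))) (D : Set (ℤ × ℤ)) (q₀ : slab 3 k),
      S ⊆ Kfin → S' ⊆ Kfin → planar k q₀ ∈ D → (∃ z : ℤ × ℤ, D ⊆ sqBox z r) →
      (∀ e, e ∉ touch k D → (e ∈ (↑S : BondConfig (slab 3 k)) ↔ e ∈ (↑S' : BondConfig (slab 3 k)))) →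
      ∀ e, e ∉ box q₀ → (e ∈ S ↔ e ∈ S') := by
    intro S S' D q₀ hS hS' hq₀D hz hag e heT
    obtain ⟨z, hDz⟩ := hz
    have hDq : D ⊆ sqBox (planar k q₀) (2 * r) := hDz.trans (sqBox_subset_double (hDz hq₀D))
    by_cases heK : e ∈ Kfin
    · have hnt : e ∉ touch k D := by
        rintro ⟨x, hx, hxD⟩
        exact heT (Finset.mem_filter.2 ⟨heK, x, hx, (Set.Finite.mem_toFinset _).2 (hDq hxD)⟩)
      have := hag e hnt
      simp only [Finset.mem_coe] at this
      exact this
    · constructor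
      · intro heS; exact absurd (hS heS) heK
      · intro heS'; exact absurd (hS' heS') heK
  have hmain := lemma7_bond (slabGraph 3 k) p hp0 hp1 K' Kfin hK hE hF s zero_lt_one Φ ?_ ?_ ?_
  · calc P.real E ≤ lam ^ s / 1 * P.real F := hmain
      _ = lam ^ s * P.real F := by rw [div_one]
  · intro S hS hSA S' hS'
    have h : (↑S : Set (Sym2 (slab 3 k))) ⊆ (slabGraph 3 k).edgeSet ∧ (↑S : BondConfig (slab 3 k)) ∈ E :=
      ⟨hlat S hS, hSA⟩
    rw [hΦ_of S h, Finset.mem_singleton] at hS'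
    subst hS'
    refine ⟨Finset.filter_subset _ _, ?_⟩
    rw [hcoe S hS hSA]
    exact (hgad' (↑S) h).1
  · intro S hS hSA
    have h : (↑S : Set (Sym2 (slab 3 k))) ⊆ (slabGraph 3 k).edgeSet ∧ (↑S : BondConfig (slab 3 k)) ∈ E :=
      ⟨hlat S hS, hSA⟩
    rw [hΦ_of S h]
    simp
  · intro S' hS' _
    set ω' : BondConfig (slab 3 k) := ↑S' with hω'
    set T : Finset (Sym2 (slab 3 k)) := if h : (stat ω').Nonempty then box h.some else ∅ with hT
    have hTc : T.card ≤ s := by rw [hT]; split_ifs <;> simp [hbox_card]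
    refine ⟨T, hTc, ?_⟩
    intro S hS hSA hmem e heT
    have h : (↑S : Set (Sym2 (slab 3 k))) ⊆ (slabGraph 3 k).edgeSet ∧ (↑S : BondConfig (slab 3 k)) ∈ E :=
      ⟨hlat S hS, hSA⟩
    rw [hΦ_of S h, Finset.mem_singleton] at hmem
    have hω'eq : ω' = gad ↑S h := by rw [hω', hmem, hcoe S hS hSA]
    obtain ⟨D, hag, hz, hne, hsub⟩ := (hgad' ↑S h).2.2
    have hag' : ∀ e', e' ∉ touch k D →
        (e' ∈ (↑S : BondConfig (slab 3 k)) ↔ e' ∈ (↑S' : BondConfig (slab 3 k))) := by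
      intro e' he'
      rw [show ((↑S' : BondConfig (slab 3 k))) = gad ↑S h from hω' ▸ hω'eq]
      exact hag e' he'
    rw [← hω'eq] at hne hsub
    have hT' : T = box hne.some := by rw [hT, dif_pos hne]
    have hq₀D : planar k hne.some ∈ D := by
      have := hsub hne.some_mem; rwa [mem_slabLift_iff] at this
    exact hbox_agree S S' D hne.some hS hS' hq₀D hz hag' e (hT' ▸ heT)

/-! ## Locality of the circuit-gluing events in the world -/

namespace CircGlue

variable {D : CircGlue k}

/-- `Γ` is determined by the pairs over the annulus. [cite: NewmanTassionWu2017, §3.2 (CPAM Theorem 3.10: measurability in the edge variables of the annulus)] -/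
theorem Γ_congr_annulus {ω ω' : BondConfig (slab 3 k)}
    (h : ∀ e ∈ (slabLift k (annulus D.c D.m D.n)).sym2, (e ∈ ω ↔ e ∈ ω')) : D.Γ ω = D.Γ ω' := by
  have key : ∀ {ω₁ ω₂ : BondConfig (slab 3 k)}, (∀ e ∈ (slabLift k (annulus D.c D.m D.n)).sym2, (e ∈ ω₁ ↔ e ∈ ω₂)) →
      ∀ l, IsOpenCircuit k ω₁ (slabLift k (annulus D.c D.m D.n)) l → IsOpenCircuit k ω₂ (slabLift k (annulus D.c D.m D.n)) l := by
    intro ω₁ ω₂ h12 l hl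
    exact hl.of_edges fun a ha b hb hab => (h12 _ (Set.mk_mem_sym2_iff.2 ⟨hl.subset a ha, hl.subset b hb⟩)).1 hab
  have h' : ∀ e ∈ (slabLift k (annulus D.c D.m D.n)).sym2, (e ∈ ω' ↔ e ∈ ω) := fun e he => (h e he).symm
  by_cases hH : ω ∈ D.evH
  · obtain ⟨⟨h1, h1'⟩, h2⟩ := Γ_spec hH
    refine (minCircuit_eq_of_min (key h _ h1) h1' fun l' hl' hs' => h2 l' (key h' _ hl') hs').symm
  · have hH' : ω' ∉ D.evH := fun ⟨l, hl, hs⟩ => hH ⟨l, key h' _ hl, hs⟩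
    show minCircuit k ω D.c D.m D.n = minCircuit k ω' D.c D.m D.n
    rw [minCircuit_eq_nil hH, minCircuit_eq_nil hH']

/-- Pairs over a smaller planar set are pairs over a larger one. [cite: NewmanTassionWu2017, §3.2 (CPAM Theorem 3.10)] -/
theorem sym2_slabLift_mono {A B : Set (ℤ × ℤ)} (hAB : A ⊆ B) : (slabLift k A).sym2 ⊆ (slabLift k B).sym2 := by
  intro e he
  induction e using Sym2.ind with
  | h _ _ =>
    rw [Set.mk_mem_sym2_iff] at he ⊢
    exact ⟨slabLift_mono k hAB he.1, slabLift_mono k hAB he.2⟩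

/-- Agreement on the pairs over the world gives the same `Γ` and the same source. [cite: NewmanTassionWu2017, §3.2 (CPAM Theorem 3.10)] -/
theorem Γ_src_congr_W {ω ω' : BondConfig (slab 3 k)} (h : ∀ e ∈ (slabLift k D.W).sym2, (e ∈ ω ↔ e ∈ ω')) :
    D.Γ ω = D.Γ ω' ∧ D.src ω = D.src ω' :=
  ⟨Γ_congr_annulus fun e he => h e (sym2_slabLift_mono D.hAW he), D.hsrc_loc ω ω' fun e he _ => h e he⟩

/-- An open connection inside `W̄` depends only on the pairs over `W`. [cite: NewmanTassionWu2017, §3.2 (CPAM Theorem 3.10)] -/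
theorem openConnIn_congr_W {ω ω' : BondConfig (slab 3 k)} (h : ∀ e ∈ (slabLift k D.W).sym2, (e ∈ ω ↔ e ∈ ω'))
    {x z : slab 3 k} {T : Set (slab 3 k)} (hT : T ⊆ slabLift k D.W) (hx : ω ∈ openConnIn T x z) :
    ω' ∈ openConnIn T x z :=
  openConnIn_of_subset_on hx fun _ ha _ hb hab => (h _ (Set.mk_mem_sym2_iff.2 ⟨hT ha, hT hb⟩)).1 hab

/-- `evCol` is determined by the pairs over the world. [cite: NewmanTassionWu2017, §3.2 (CPAM Theorem 3.10)] -/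
theorem mem_evCol_congr {ω ω' : BondConfig (slab 3 k)} (h : ∀ e ∈ (slabLift k D.W).sym2, (e ∈ ω ↔ e ∈ ω')) :
    ω ∈ D.evCol ↔ ω' ∈ D.evCol := by
  have key : ∀ {ω₁ ω₂ : BondConfig (slab 3 k)}, (∀ e ∈ (slabLift k D.W).sym2, (e ∈ ω₁ ↔ e ∈ ω₂)) →
      ω₁ ∈ D.evCol → ω₂ ∈ D.evCol := by
    intro ω₁ ω₂ h12 ⟨c₀, hc₀, q, hj, hn⟩
    obtain ⟨hΓ, hsrc⟩ := Γ_src_congr_W h12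
    exact ⟨c₀, hsrc ▸ hc₀, q, openConnIn_congr_W h12 subset_rfl hj, hΓ ▸ hn⟩
  exact ⟨key h, key fun e he => (h e he).symm⟩

/-- `evGlued` is determined by the pairs over the world. [cite: NewmanTassionWu2017, §3.2 (CPAM Theorem 3.10)] -/
theorem mem_evGlued_congr {ω ω' : BondConfig (slab 3 k)} (h : ∀ e ∈ (slabLift k D.W).sym2, (e ∈ ω ↔ e ∈ ω')) :
    ω ∈ D.evGlued ↔ ω' ∈ D.evGlued := by
  have key : ∀ {ω₁ ω₂ : BondConfig (slab 3 k)}, (∀ e ∈ (slabLift k D.W).sym2, (e ∈ ω₁ ↔ e ∈ ω₂)) →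
      ω₁ ∈ D.evGlued → ω₂ ∈ D.evGlued := by
    intro ω₁ ω₂ h12 ⟨c₀, hc₀, g, hg, hj⟩
    obtain ⟨hΓ, hsrc⟩ := Γ_src_congr_W h12
    exact ⟨c₀, hsrc ▸ hc₀, g, hΓ ▸ hg, openConnIn_congr_W h12 subset_rfl hj⟩
  exact ⟨key h, key fun e he => (h e he).symm⟩

/-- The finite window of pairs over the world, and the determinacy of the three events by it.
[cite: NewmanTassionWu2017, §3.2 (CPAM Theorem 3.10)] -/
theorem determinedBy_events :
    DeterminedBy D.evX (slabLift k D.W).sym2 ∧ DeterminedBy D.evGlued (slabLift k D.W).sym2 ∧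
      DeterminedBy D.evCol (slabLift k D.W).sym2 := by
  have hag : ∀ ω ω' : BondConfig (slab 3 k), ω ∩ (slabLift k D.W).sym2 = ω' ∩ (slabLift k D.W).sym2 →
      ∀ e ∈ (slabLift k D.W).sym2, (e ∈ ω ↔ e ∈ ω') := by
    intro ω ω' heq e he
    have := Set.ext_iff.1 heq e
    simp only [Set.mem_inter_iff, he, and_true] at this
    exact this
  refine ⟨?_, ?_, ?_⟩ <;> rw [determinedBy_iff] <;> intro ω ω' heq
  · simp only [evX, Set.mem_inter_iff, Set.mem_compl_iff]
    rw [mem_evCol_congr (hag ω ω' heq), mem_evGlued_congr (hag ω ω' heq)]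
  · exact mem_evGlued_congr (hag ω ω' heq)
  · exact mem_evCol_congr (hag ω ω' heq)

/-! ## Entry cells exist on `𝒳` -/

/-- **On `𝒳`, a lattice configuration has an entry cell**: follow an open path inside `W̄` from the source to
a vertex over a column of `Γ`; its first vertex over such a column, with its predecessor, is an entry.
[cite: NewmanTassionWu2017, §3.2 (CPAM Theorem 3.10: U(ω) ≠ ∅ on the event)] -/
theorem exists_mem_Uent_of_evX {ω : BondConfig (slab 3 k)} (hω : ω ⊆ (slabGraph 3 k).edgeSet)
    (hX : ω ∈ D.evX) : ∃ y, y ∈ D.Uent ω := by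
  obtain ⟨c₀, hc₀, q, hj, hnear⟩ := hX.1
  obtain ⟨L, hL⟩ := exists_isOSAP_of_openConnIn hj
  have hqL : q ∈ L := by
    have := hL.last_mem hL.ne_nil
    rw [Set.mem_singleton_iff] at this
    rw [← this]; exact List.getLast_mem _
  obtain ⟨P₀, v, T, hLeq, hv, hP₀⟩ :=
    exists_first_split (p := fun x => Near k (D.Γ ω) 0 (planar k x)) L ⟨q, hqL, hnear⟩
  have hhead : L.head hL.ne_nil = c₀ := by simpa using hL.head_mem hL.ne_nil
  have hP₀ne : P₀ ≠ [] := by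
    rintro rfl
    have : v = c₀ := by rw [← hhead]; simp [hLeq]
    subst this
    exact not_near_src (D := D) hc₀ hv
  set u := P₀.getLast hP₀ne with hu
  have hLeq' : L = P₀.dropLast ++ u :: v :: T := by
    rw [hLeq]; conv_lhs => rw [← List.dropLast_append_getLast hP₀ne]
    simp [hu]
  have huv : s(u, v) ∈ ω ∧ u ≠ v := (List.isChain_iff_forall_rel_of_append_cons_cons.1 hL.chain) hLeq'
  have hadj : (slabGraph 3 k).Adj u v := (SimpleGraph.mem_edgeSet _).1 (hω huv.1)
  have hufar : ¬Near k (D.Γ ω) 0 (planar k u) := hP₀ u (List.getLast_mem hP₀ne)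
  -- the prefix `P₀` is an open path off the columns of `Γ`, inside `W̄`, from `c₀` to `u`
  have hjf : D.JoinedFar ω u := by
    refine ⟨c₀, hc₀, ?_⟩
    obtain ⟨a, P₀', hP₀eq⟩ := List.exists_cons_of_ne_nil hP₀ne
    have hch : (a :: P₀').IsChain (fun x z => s(x, z) ∈ ω ∧ x ≠ z) := by
      have := hL.chain; rw [hLeq, hP₀eq] at this
      exact (List.isChain_append.1 this).1
    have hsub : ∀ x ∈ a :: P₀', x ∈ slabLift k D.W ∩ {x | ¬Near k (D.Γ ω) 0 (planar k x)} := by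
      intro x hx
      refine ⟨hL.subset x (by rw [hLeq, hP₀eq]; exact List.mem_append_left _ hx), hP₀ x (hP₀eq ▸ hx)⟩
    have hconn := openConnIn_of_isChain a P₀' hch hsub
    have ha : a = c₀ := by rw [← hhead]; simp [hLeq, hP₀eq]
    have hlast : (a :: P₀').getLast (List.cons_ne_nil _ _) = u := by simp only [hu, hP₀eq]
    rw [hlast] at hconn
    subst ha
    exact hconn
  exact ⟨planar k v, hv, u, v, rfl, hadj, hufar, hjf⟩

/-! ## The linear bound -/

/-- **`P_p[𝒳] ≤ λ^{5k+4} · P_p[C̄ ⟷ Γ]`** for every circuit-gluing datum and `0 < p < 1`: Lemma 3.5 applied to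
the vertical gadgets (`exists_vGadget`) at one entry cell of each lattice configuration of `𝒳`.
[cite: NewmanTassionWu2017, §3.2 (CPAM Theorem 3.10 with Remark 3: h₀(x) ≥ c₀ x)] -/
theorem real_evX_le (D : CircGlue k) (p : unitInterval) (hp0 : 0 < (p : ℝ)) (hp1 : (p : ℝ) < 1) :
    (bondPercolation (slabGraph 3 k) p).real D.evX ≤
      (2 / min (p : ℝ) (1 - p)) ^ (5 * k + 4) * (bondPercolation (slabGraph 3 k) p).real D.evGlued := by
  classical
  have hWfin : (slabLift k D.W).Finite := slabLift_finite k D.hWfin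
  set K' : Finset (Sym2 (slab 3 k)) := (finite_sym2 hWfin).toFinset with hK'
  have hK'coe : (↑K' : Set (Sym2 (slab 3 k))) = (slabLift k D.W).sym2 := Set.Finite.coe_toFinset _
  obtain ⟨hdX, hdG, -⟩ := determinedBy_events (D := D)
  have h := real_le_of_statMods (slabLift k D.W) K' (by rw [hK'coe]) (by rw [hK'coe]; exact hdX)
    (by rw [hK'coe]; exact hdG) D.att 0 p hp0 hp1 ?_
  · simpa using h
  · intro ω hω hX
    obtain ⟨y, hy⟩ := exists_mem_Uent_of_evX hω hX
    obtain ⟨ω', hg⟩ := exists_vGadget hX hy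
    refine ⟨ω', hg.mem, hg.window, {y}, hg.agree, ⟨y, fun z hz => ?_⟩, hg.att_nonempty, hg.att_subset⟩
    rw [Set.mem_singleton_iff] at hz
    rw [hz]; exact mem_sqBox_self _ _

/-- **The circuit gluing lemma, linear regime**: `P_p[C̄ ⟷^{W̄} col(Γ)] ≤ (1 + λ^{5k+4}) · P_p[C̄ ⟷^{W̄} Γ]`
for every `CircGlue` datum (any finite world containing the annulus, any source off the box of the
annulus) and every `0 < p < 1`, `λ = 2/min{p,1-p}`.  This is Theorem 3.8 (arXiv) / 3.10 (CPAM) in the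
linear regime of Remark 3, for ONE gluing step ((3.5) or (3.6)).
[cite: NewmanTassionWu2017, §3.2 (CPAM Theorem 3.10, (3.5)–(3.6), with Remark 3: h₀(x) ≥ c₀ x)] -/
theorem circuitGlue_linear (D : CircGlue k) (p : unitInterval) (hp0 : 0 < (p : ℝ)) (hp1 : (p : ℝ) < 1) :
    (bondPercolation (slabGraph 3 k) p).real D.evCol ≤
      (1 + (2 / min (p : ℝ) (1 - p)) ^ (5 * k + 4)) * (bondPercolation (slabGraph 3 k) p).real D.evGlued := by
  set P := bondPercolation (slabGraph 3 k) p with hP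
  have hsub : D.evCol ⊆ D.evX ∪ D.evGlued := by
    intro ω hω
    by_cases h : ω ∈ D.evGlued
    · exact Or.inr h
    · exact Or.inl ⟨hω, h⟩
  have h1 := real_evX_le D p hp0 hp1
  calc P.real D.evCol ≤ P.real (D.evX ∪ D.evGlued) := measureReal_mono hsub
    _ ≤ P.real D.evX + P.real D.evGlued := measureReal_union_le _ _
    _ ≤ _ := by rw [add_mul, one_mul, add_comm]; gcongr

end CircGlue

end NTW17

end Literature.Probability.Percolation

end
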